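import Summits.ABC.IUTFork.Repair.CandInternal2RealStrata
import HarnessLib

/-!
# IUT REPAIR BRANCH (rung LADDER-ABC:A2.RP → A2.RESCUE-H), class (i) INTERNAL, sub-cell B0, seat rp-d2 — `CandInternal2RealRegion`: the REGION
# form of the R-H cell — the typed RP-I06⋆ is a REGION inclusion `q̲·𝒪_w ⊆ q̲^{j²}·ℐ_w` (reading R-a), and every POS / NEG cell of the column block is one

PROOF-ONLY file (D-0012; 0 definitions, 0 `Prop` facts) of the abc-iut cell, IUT REPAIR branch; seat abc-iut-rp-d2 gen 3 (D-0079 R-H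
numerics/kernel-eval hand; liaison note «U-SHAPE, PRECISELY» of this seat on STATUS). TAKES NO SIDE on [IUTchIII] Cor. 3.12 or on any author;
classical `p`-adic analysis over this seat's `CandInternal2RealLabels` (p450037) / `CandInternal2RealStrata` (p451037, p451708); standard axioms.

WHY. `Repair.CandInternal11Gap.HQShellOrbitStar` (RP-I06⋆) is an inclusion of REGIONS (`ρ(q-datum) ⊆ ⋃_m ρ(Ψ_m·𝓘)`), not a membership of one
element. At a genuine place with q-region `q̲·𝒪_w` and Θ-datum `q̲^{j²}`, the shell-saturated SET reading (R-a) of the cell is `q̲·𝒪_w ⊆ q̲^{j²}·ℐ_w`,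
i.e. `q̲^{1−j²}·𝒪_w ⊆ ℐ_w` — decided EXACTLY by the inner conductor `A(K_w) = min{m : 𝔪^m ⊆ log_p 𝒪^×}` («(j²−1)·ord_w(q̲) ≤ e·c − A(K_w)»); the
ELEMENT lemmas of `CandInternal2RealLabels/Strata` certify it from below through BALLS (`closedBall ⊆ ℐ_w`) and refute it from above through the
single element `q̲^{1−j²}`. This file records that bookkeeping: §1 `smul_closedBall_subset_pow_smul_of_norm_le` (any normed field: `closedBall 0 r ⊆ I`,
`‖q‖ ≤ ‖q‖^n·r` ⟹ `q • closedBall 0 1 ⊆ q^n • I`); §2 at the real shell: `smul_closedBall_subset_logShell_of_height_le` (printed edge `(n−1)·h ≤ c − a_e`),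
`…_of_height_lt_sharp` (sharp edge `(n−1)·h < c − 1/(p−1)`), `…_of_root` (root form, `‖q̲‖^N = p^{−H}`; either edge) — so every POS cell of
`plan/rescue/R-H/I06STAR-COLUMNS.tsv` is a REGION-POS cell; `not_smul_closedBall_subset_of_not_mem` — every NEG cell (element `q̲ ∉ q̲^n·ℐ`) is a
REGION-NEG cell (in reading R-a and, a fortiori, in the weaker 𝒪_w-span reading R-b). Between the edges the region cell is the integer `A(K_w)`
(U-SHAPE, abc-iut-w4-d036). No judgement on print; no side taken. [claim: Mochizuki2012, status: disputed]; [cite: MochizukiAbsTopIII2015, Def 5.4 (iii) p. 126].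
-/

noncomputable section

namespace Summit.ABC.IUTFork.Repair.CandInternal2RealRegion

open Set Metric
open scoped Pointwise
open Literature.AnabelianGeometry.AbsoluteAnabelian Literature.IUT.LogThetaLattice Literature.IUT.LogVolume
  Summit.ABC.IUTFork.Repair.CandInternal2Real Summit.ABC.IUTFork.Repair.CandInternal2RealLabels Summit.ABC.IUTFork.Repair.CandInternal2RealStrata

/-! ## 1. Region form in any normed field -/

/-- **REGION form, any normed field**: if `I ⊇ closedBall 0 r`, `q ≠ 0` and `‖q‖ ≤ ‖q‖^n · r`, then the whole q-BALL lies in `q^n · I`: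
`q • closedBall 0 1 ⊆ q^n • I` (every `q·x`, `‖x‖ ≤ 1`, is `q^n · (q^{1−n}x)` with `‖q^{1−n}x‖ ≤ r`). [folklore] -/
theorem smul_closedBall_subset_pow_smul_of_norm_le {K : Type*} [NormedField K] {q : K} {n : ℕ} {I : Set K} {r : ℝ}
    (hI : closedBall (0 : K) r ⊆ I) (hq : q ≠ 0) (h : ‖q‖ ≤ ‖q‖ ^ n * r) : q • closedBall (0 : K) 1 ⊆ q ^ n • I := by
  rintro _ ⟨x, hx, rfl⟩
  refine Set.mem_smul_set.2 ⟨(q ^ n)⁻¹ * (q * x), hI ?_, ?_⟩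
  · rw [mem_closedBall, dist_zero_right] at hx ⊢
    rw [norm_mul, norm_mul, norm_inv, norm_pow]
    have hpos : 0 < ‖q‖ ^ n := pow_pos (norm_pos_iff.2 hq) n
    rw [inv_mul_le_iff₀ hpos]
    calc ‖q‖ * ‖x‖ ≤ ‖q‖ * 1 := by gcongr
      _ = ‖q‖ := mul_one _
      _ ≤ ‖q‖ ^ n * r := h
  · show q ^ n • ((q ^ n)⁻¹ * (q * x)) = q • x
    rw [smul_eq_mul, smul_eq_mul, ← mul_assoc, mul_inv_cancel₀ (pow_ne_zero n hq), one_mul]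

/-! ## 2. Region cells at the real log-shell -/

section Real

variable (p : ℕ) [Fact p.Prime]
variable (K : Type*) [NontriviallyNormedField K] [NormedAlgebra ℚ_[p] K] [IsUltrametricDist K] [ProperSpace K]

/-- **REGION CELL, printed edge**: `(n−1)·h ≤ c − a_e` ⟹ `q·𝒪_K ⊆ q^n · ℐ_K` (`𝒪_K = closedBall 0 1`, `‖q‖ = p^{−h}`). [cite: MochizukiAbsTopIII2015, Def 5.4 (iii) p. 126] -/
theorem smul_closedBall_subset_logShell_of_height_le {q : K} (hq : q ≠ 0) {h : ℝ} (hqh : ‖q‖ = (p : ℝ) ^ (-h)) {n : ℕ}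
    (hle : ((n : ℝ) - 1) * h ≤ ((if p = 2 then 2 else 1 : ℕ) : ℝ) - logRadiusA p (absRamificationIdx p K)) :
    q • closedBall (0 : K) 1 ⊆ q ^ n • logShell (PadicLogOnUnits.ofUnitLog p K) := by
  apply smul_closedBall_subset_pow_smul_of_norm_le (closedBall_radiusA_subset_logShell p K) hq
  have hp1 : (1 : ℝ) < p := by exact_mod_cast (Fact.out : p.Prime).one_lt
  have hp0 : (0 : ℝ) < p := by linarith
  rw [norm_pstar_inv_eq_rpow p K, hqh, ← Real.rpow_natCast, ← Real.rpow_mul hp0.le, ← Real.rpow_add hp0, ← Real.rpow_add hp0,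
    Real.rpow_le_rpow_left_iff hp1]
  linarith

/-- **REGION CELL, sharp edge**: `(n−1)·h < c − 1/(p−1)` ⟹ `q·𝒪_K ⊆ q^n · ℐ_K`. [cite: MochizukiAbsTopIII2015, Def 5.4 (iii) p. 126] -/
theorem smul_closedBall_subset_logShell_of_height_lt_sharp {q : K} (hq : q ≠ 0) {h : ℝ} (hqh : ‖q‖ = (p : ℝ) ^ (-h)) {n : ℕ}
    (hlt : ((n : ℝ) - 1) * h < ((if p = 2 then 2 else 1 : ℕ) : ℝ) - 1 / ((p : ℝ) - 1)) :
    q • closedBall (0 : K) 1 ⊆ q ^ n • logShell (PadicLogOnUnits.ofUnitLog p K) := by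
  have ha : 1 / ((p : ℝ) - 1) < ((if p = 2 then 2 else 1 : ℕ) : ℝ) - ((n : ℝ) - 1) * h := by linarith
  apply smul_closedBall_subset_pow_smul_of_norm_le (closedBall_subset_logShell_of_lt p K ha) hq
  have hp1 : (1 : ℝ) < p := by exact_mod_cast (Fact.out : p.Prime).one_lt
  have hp0 : (0 : ℝ) < p := by linarith
  rw [norm_pstar_inv_eq_rpow p K, hqh, ← Real.rpow_natCast, ← Real.rpow_mul hp0.le, ← Real.rpow_add hp0, ← Real.rpow_add hp0,
    Real.rpow_le_rpow_left_iff hp1]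
  linarith

/-- **REGION CELL, root form** (`‖q̲‖^N = p^{−H}`; intended `N = 2l`, `n = j²`): `(n−1)·H ≤ N·(c − a_e)` OR `(n−1)·H < N·(c − 1/(p−1))`
⟹ `q̲·𝒪_K ⊆ q̲^n · ℐ_K` — the I06STAR-COLUMNS POS cells read as REGION cells. [claim: Mochizuki2012, status: disputed] -/
theorem smul_closedBall_subset_logShell_of_root {q : K} (hq : q ≠ 0) {N : ℕ} (hN : 0 < N) {H : ℝ} (hqN : ‖q‖ ^ N = (p : ℝ) ^ (-H)) {n : ℕ}
    (hle : ((n : ℝ) - 1) * H ≤ N * (((if p = 2 then 2 else 1 : ℕ) : ℝ) - logRadiusA p (absRamificationIdx p K)) ∨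
      ((n : ℝ) - 1) * H < N * (((if p = 2 then 2 else 1 : ℕ) : ℝ) - 1 / ((p : ℝ) - 1))) :
    q • closedBall (0 : K) 1 ⊆ q ^ n • logShell (PadicLogOnUnits.ofUnitLog p K) := by
  have hqh := norm_eq_rpow_of_pow_eq p (Nat.pos_iff_ne_zero.1 hN) hqN
  have hN' : (0 : ℝ) < N := by exact_mod_cast hN
  rcases hle with hle | hlt
  · refine smul_closedBall_subset_logShell_of_height_le p K hq hqh ?_
    rw [← mul_div_assoc, div_le_iff₀ hN']
    linarith
  · refine smul_closedBall_subset_logShell_of_height_lt_sharp p K hq hqh ?_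
    rw [← mul_div_assoc, div_lt_iff₀ hN']
    linarith

/-- **REGION NEG from the element NEG**: if even the element `q` is not in `q^n · ℐ_K` then the q-ball is not inside it (`q = q·1 ∈ q·𝒪_K`) — every NEG
cell of the column block is a REGION-NEG cell, in reading R-a and a fortiori in the weaker 𝒪-span reading R-b. [folklore] -/
theorem not_smul_closedBall_subset_of_not_mem {q : K} {n : ℕ} (hn : q ∉ q ^ n • logShell (PadicLogOnUnits.ofUnitLog p K)) :
    ¬ q • closedBall (0 : K) 1 ⊆ q ^ n • logShell (PadicLogOnUnits.ofUnitLog p K) := fun hsub =>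
  hn (hsub ⟨1, by simp, by simp⟩)

/-- **REGION NEG, root form**: `N·(b_e + c) < (n−1)·H` ⟹ `¬ q̲·𝒪_K ⊆ q̲^n · ℐ_K`. [claim: Mochizuki2012, status: disputed] -/
theorem not_smul_closedBall_subset_of_root_lt {q : K} {N : ℕ} (hN : 0 < N) {H : ℝ} (hqN : ‖q‖ ^ N = (p : ℝ) ^ (-H)) {n : ℕ}
    (hlt : (N : ℝ) * (logRadiusB p (absRamificationIdx p K) + ((if p = 2 then 2 else 1 : ℕ) : ℝ)) < ((n : ℝ) - 1) * H) :
    ¬ q • closedBall (0 : K) 1 ⊆ q ^ n • logShell (PadicLogOnUnits.ofUnitLog p K) :=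
  not_smul_closedBall_subset_of_not_mem p K (not_mem_pow_smul_logShell_of_root_lt p K hN hqN hlt)

/-- **INNER-CONDUCTOR form (the exact R-a decider, hypothesis-style)**: if a ball `closedBall 0 R ⊆ ℐ_K` is known (e.g. `R = ‖p*‖⁻¹·p^{−A(K)/e}` from the
inner conductor `A(K)`, U-SHAPE) and `‖q‖ ≤ ‖q‖^n · R`, then `q·𝒪_K ⊆ q^n·ℐ_K` — the slot where abc-iut-w4-d036's `A(K_w)` plugs in. [folklore] -/
theorem smul_closedBall_subset_logShell_of_ball {q : K} (hq : q ≠ 0) {n : ℕ} {R : ℝ}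
    (hR : closedBall (0 : K) R ⊆ logShell (PadicLogOnUnits.ofUnitLog p K)) (h : ‖q‖ ≤ ‖q‖ ^ n * R) :
    q • closedBall (0 : K) 1 ⊆ q ^ n • logShell (PadicLogOnUnits.ofUnitLog p K) :=
  smul_closedBall_subset_pow_smul_of_norm_le hR hq h

end Real

end Summit.ABC.IUTFork.Repair.CandInternal2RealRegion

end
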